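import Summits.AtomisticToContinuum.Crystallization.Theorems.PerronTransitivityUniformBindingRigidityCohesionP
import Summits.AtomisticToContinuum.Crystallization.Theorems.PerronTransitivityUniformBindingRigidityCohesionQ

/-!
# Cohesion of uniformly bound Lennard-Jones configurations, XX: the separation rung `16/25`

Helper file (`--supports stmt-AtomisticToContinuum-15099`) proving the registered stub
`stub_sepSixteen` (= `(SEP¹⁶)`, skeleton `Lines/birth.lean` rev 7) of the line `registered` of the
crux `Summit.AtomisticToContinuum.Crystallization.Theses.PerronTransitivity.UniformBindingRigidity`
(item stmt-AtomisticToContinuum-15099).  Notation `U_Y(p) = Σ'_{q ∈ Y, q ≠ p} V_LJ(dist p q)`,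
`T(δ, R) = 16/(δ³R³) + 18/(δ²R⁴) + 36/(5δR⁵) + 1/R⁶` (the sharp tail of parts XIII–XIV), and
`N = {q ∈ Y ∖ {p} : dist q p ≤ R}` the near set of a site `p` at the truncation radius `R`.

The separation ladder `1/4 → 9/20 → 23/40 → 31/50` (parts X/XV/XVII: `stub_sepBootstrap`,
`sepSharp`, `stub_sepThirtyOne`) is extended by one rung.  The infimum-of-distances argument of
part XVII is repeated verbatim (pair-selection constant `(11/10)^{1/12}`, truncation radius
`13/10`), with ONE change: the plain truncation `sum_near_sub_sharpTail_le_tsum` (allowance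
`T(m, R)/6`) is replaced by the CREDITED truncation `sum_near_sub_creditTail_le_tsum` of part XIX
(allowance `(1/6)(T(m, R) − (#N + 1) R⁻⁶)`), so that every near point costs `1/12 − R⁻⁶/6`
(`≈ 0.0488` at `R = 13/10`) instead of `1/12`:

* §36 the endpoint numerics `sepSixteen_numerics` on
  `[31/50, 63/100] ∪ [63/100, 159/250] ∪ [159/250, 16/25]` (margins `> 2.8, 1.5, 0.8`);
* §37 `stub_sepSixteen` — a `31/50`-separated `Y ⊆ ℝ³` all of whose site sums are `≤ −711/500`
  is `16/25`-separated — and the composite from `1/4`, `sep_of_quarter_sixteen`;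
* §38 the instance `local_sixteen_of_finiteCert_credit` of the credited finite-certificate
  reduction `local_of_finiteCert_credit_at` (part XIX) at `(δ, r, Λ) = (16/25, 6, −711/500)`,
  whose conclusion is literally the rev-7 stub `stub_localHalfSpaceCert` — it records
  `FINCERT(16/25) ⇒ LOCAL(16/25)` and neither proves nor assumes that stub.

All `[folklore]`.
-/

noncomputable section

namespace Summit.AtomisticToContinuum.Crystallization.Theorems.PerronTransitivityUniformBindingRigidity

open scoped BigOperators Topology
open Filter Set Metric
open Literature.MathematicalPhysics.StatisticalMechanics
open Summit.AtomisticToContinuum.Crystallization.Theorems.ChargedEnergyGapNegative (E3)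

/-! ## §36 Numerics of the rung `31/50 → 16/25` -/

/-- **Numerics of the rung `16/25`.** For `31/50 ≤ m ≤ 16/25`, with `R = 13/10` and the packing
count `K = (2R/m + 1)³ − 1` of the near set:
`m⁻⁶/6 + (1/12 − R⁻⁶/6) K − 1/12 + T(m, R)/6 − R⁻⁶/6 − 711/500 < (1/12)((11/10) m¹²)⁻¹`
(three cases; every term is monotone in `m` and is bounded at the unfavourable endpoint of its
interval). [folklore] -/
theorem sepSixteen_numerics {m : ℝ} (h1 : 31 / 50 ≤ m) (h2 : m ≤ 16 / 25) :
    1 / 6 * m⁻¹ ^ 6 +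
        (1 / 12 - 1 / 6 * (13 / 10 : ℝ)⁻¹ ^ 6) * ((2 * (13 / 10) / m + 1) ^ 3 - 1) - 1 / 12 +
        1 / 6 * (16 / (m ^ 3 * (13 / 10) ^ 3) + 18 / (m ^ 2 * (13 / 10) ^ 4) +
          36 / (5 * m * (13 / 10) ^ 5) + 1 / (13 / 10 : ℝ) ^ 6) -
        1 / 6 * (13 / 10 : ℝ)⁻¹ ^ 6 - 711 / 500 <
      1 / 12 * ((11 / 10) * m ^ 12)⁻¹ := by
  have hm0 : 0 < m := by linarith
  have h13 : (0 : ℝ) < 13 / 10 := by norm_num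
  have hcoef : (0 : ℝ) ≤ 1 / 12 - 1 / 6 * (13 / 10 : ℝ)⁻¹ ^ 6 := by norm_num
  rcases le_total m (63 / 100) with h | h
  · -- `31/50 ≤ m ≤ 63/100`
    have hA : (1 : ℝ) / 12 * ((11 / 10) * (63 / 100 : ℝ) ^ 12)⁻¹ ≤
        1 / 12 * ((11 / 10) * m ^ 12)⁻¹ := by
      gcongr
    have hA' : (1937 / 100 : ℝ) ≤ 1 / 12 * ((11 / 10) * (63 / 100 : ℝ) ^ 12)⁻¹ := by norm_num
    have hB : m⁻¹ ^ 6 ≤ (31 / 50 : ℝ)⁻¹ ^ 6 := by gcongr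
    have hB' : (31 / 50 : ℝ)⁻¹ ^ 6 ≤ 1761 / 100 := by norm_num
    have hC : (2 * (13 / 10) / m + 1) ^ 3 ≤ (2 * (13 / 10) / (31 / 50 : ℝ) + 1) ^ 3 := by gcongr
    have hC' : (2 * (13 / 10) / (31 / 50 : ℝ) + 1) ^ 3 ≤ 14009 / 100 := by norm_num
    have hCC := mul_le_mul_of_nonneg_left (hC.trans hC') hcoef
    have hD := sharpTail_anti (by norm_num : (0 : ℝ) < 31 / 50) h1 h13
    have hD' : 16 / ((31 / 50 : ℝ) ^ 3 * (13 / 10) ^ 3) + 18 / ((31 / 50 : ℝ) ^ 2 * (13 / 10) ^ 4) +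
        36 / (5 * (31 / 50 : ℝ) * (13 / 10) ^ 5) + 1 / (13 / 10 : ℝ) ^ 6 ≤ 5029 / 100 := by
      norm_num
    linarith
  rcases le_total m (159 / 250) with h' | h'
  · -- `63/100 ≤ m ≤ 159/250`
    have hA : (1 : ℝ) / 12 * ((11 / 10) * (159 / 250 : ℝ) ^ 12)⁻¹ ≤
        1 / 12 * ((11 / 10) * m ^ 12)⁻¹ := by
      gcongr
    have hA' : (1729 / 100 : ℝ) ≤ 1 / 12 * ((11 / 10) * (159 / 250 : ℝ) ^ 12)⁻¹ := by norm_num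
    have hB : m⁻¹ ^ 6 ≤ (63 / 100 : ℝ)⁻¹ ^ 6 := by gcongr
    have hB' : (63 / 100 : ℝ)⁻¹ ^ 6 ≤ 16 := by norm_num
    have hC : (2 * (13 / 10) / m + 1) ^ 3 ≤ (2 * (13 / 10) / (63 / 100 : ℝ) + 1) ^ 3 := by gcongr
    have hC' : (2 * (13 / 10) / (63 / 100 : ℝ) + 1) ^ 3 ≤ 13477 / 100 := by norm_num
    have hCC := mul_le_mul_of_nonneg_left (hC.trans hC') hcoef
    have hD := sharpTail_anti (by norm_num : (0 : ℝ) < 63 / 100) h h13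
    have hD' : 16 / ((63 / 100 : ℝ) ^ 3 * (13 / 10) ^ 3) +
        18 / ((63 / 100 : ℝ) ^ 2 * (13 / 10) ^ 4) +
        36 / (5 * (63 / 100 : ℝ) * (13 / 10) ^ 5) + 1 / (13 / 10 : ℝ) ^ 6 ≤ 4829 / 100 := by
      norm_num
    linarith
  · -- `159/250 ≤ m ≤ 16/25`
    have hA : (1 : ℝ) / 12 * ((11 / 10) * (16 / 25 : ℝ) ^ 12)⁻¹ ≤
        1 / 12 * ((11 / 10) * m ^ 12)⁻¹ := by
      gcongr
    have hA' : (1604 / 100 : ℝ) ≤ 1 / 12 * ((11 / 10) * (16 / 25 : ℝ) ^ 12)⁻¹ := by norm_num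
    have hB : m⁻¹ ^ 6 ≤ (159 / 250 : ℝ)⁻¹ ^ 6 := by gcongr
    have hB' : (159 / 250 : ℝ)⁻¹ ^ 6 ≤ 1511 / 100 := by norm_num
    have hC : (2 * (13 / 10) / m + 1) ^ 3 ≤ (2 * (13 / 10) / (159 / 250 : ℝ) + 1) ^ 3 := by
      gcongr
    have hC' : (2 * (13 / 10) / (159 / 250 : ℝ) + 1) ^ 3 ≤ 13173 / 100 := by norm_num
    have hCC := mul_le_mul_of_nonneg_left (hC.trans hC') hcoef
    have hD := sharpTail_anti (by norm_num : (0 : ℝ) < 159 / 250) h' h13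
    have hD' : 16 / ((159 / 250 : ℝ) ^ 3 * (13 / 10) ^ 3) +
        18 / ((159 / 250 : ℝ) ^ 2 * (13 / 10) ^ 4) +
        36 / (5 * (159 / 250 : ℝ) * (13 / 10) ^ 5) + 1 / (13 / 10 : ℝ) ^ 6 ≤ 4715 / 100 := by
      norm_num
    linarith

/-! ## §37 The separation rung `31/50 → 16/25` -/

/-- **The rung `16/25` (registered stub `stub_sepSixteen`).** A `31/50`-separated `Y ⊆ ℝ³` all of
whose Lennard-Jones site sums are `≤ −711/500` is `16/25`-separated.  With `m = inf` of the mutual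
distances (`31/50 ≤ m < 16/25` if the conclusion failed), `Y` is `m`-separated; at a pair `a ≠ b`
with `dist a b < (11/10)^{1/12} m` (so `(dist a b)⁻¹² > ((11/10) m¹²)⁻¹`, `(dist a b)⁻⁶ ≤ m⁻⁶`,
`dist a b ≤ 13/10`) truncate `U_Y(a)` at radius `R = 13/10` with the CREDITED tail (part XIX,
`sum_near_sub_creditTail_le_tsum`): the near sum over the near set `N ∋ b` is `V_LJ(dist a b)` plus
at least `−(#N − 1)/12`, the allowance is `(1/6)(T(m, R) − (#N + 1) R⁻⁶)`, so
`U_Y(a) ≥ V_LJ(dist a b) + 1/12 + R⁻⁶/6 − #N (1/12 − R⁻⁶/6) − T(m, R)/6` with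
`#N ≤ (2R/m + 1)³ − 1` (`card_near_le`) and `1/12 − R⁻⁶/6 > 0`, and `sepSixteen_numerics`
contradicts `U_Y(a) ≤ −711/500`. [folklore] -/
theorem stub_sepSixteen :
    ∀ Y : Set (EuclideanSpace ℝ (Fin 3)),
      (∀ p ∈ Y, ∀ q ∈ Y, p ≠ q → 31 / 50 ≤ dist p q) →
      (∀ p ∈ Y, ∑' q : {q : EuclideanSpace ℝ (Fin 3) // q ∈ Y ∧ q ≠ p},
          lennardJones (dist p q.1) ≤ -(711 / 500)) →
      ∀ p ∈ Y, ∀ q ∈ Y, p ≠ q → 16 / 25 ≤ dist p q := by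
  classical
  intro Y hsep hU
  by_contra hcon
  push Not at hcon
  obtain ⟨p₀, hp₀, q₀, hq₀, hne₀, hlt₀⟩ := hcon
  -- the infimum `m` of the mutual distances
  set S : Set ℝ := {r | ∃ a ∈ Y, ∃ b ∈ Y, a ≠ b ∧ r = dist a b} with hS
  have hSne : S.Nonempty := ⟨dist p₀ q₀, p₀, hp₀, q₀, hq₀, hne₀, rfl⟩
  have hSbdd : BddBelow S :=
    ⟨31 / 50, by rintro r ⟨a, ha, b, hb, hab, rfl⟩; exact hsep a ha b hb hab⟩
  set m : ℝ := sInf S with hm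
  have h31m : 31 / 50 ≤ m :=
    le_csInf hSne (by rintro r ⟨a, ha, b, hb, hab, rfl⟩; exact hsep a ha b hb hab)
  have hm0 : 0 < m := by linarith
  have hmsep : ∀ a ∈ Y, ∀ b ∈ Y, a ≠ b → m ≤ dist a b := fun a ha b hb hab =>
    csInf_le hSbdd ⟨a, ha, b, hb, hab, rfl⟩
  have hm16 : m < 16 / 25 := (csInf_le hSbdd ⟨p₀, hp₀, q₀, hq₀, hne₀, rfl⟩).trans_lt hlt₀
  -- a pair at distance `< (11/10)^{1/12} m`
  set c : ℝ := (11 / 10 : ℝ) ^ ((1 : ℝ) / 12) with hc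
  have hc1 : 1 < c := Real.one_lt_rpow (by norm_num) (by norm_num)
  have hc12 : c ^ 12 = 11 / 10 := by
    rw [show (c ^ 12 : ℝ) = c ^ ((12 : ℕ) : ℝ) from (Real.rpow_natCast c 12).symm, hc,
      ← Real.rpow_mul (by norm_num : (0 : ℝ) ≤ 11 / 10)]
    norm_num
  have hmc : m < m * c := lt_mul_right hm0 hc1
  obtain ⟨r, ⟨a, ha, b, hb, hab, rfl⟩, hr⟩ := exists_lt_of_csInf_lt hSne (hm ▸ hmc)
  -- the distinguished distance `dist a b`
  have hdm : m ≤ dist a b := hmsep a ha b hb hab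
  have hd0 : 0 < dist a b := hm0.trans_le hdm
  have hd12 : (dist a b) ^ 12 < 11 / 10 * m ^ 12 := by
    calc (dist a b) ^ 12 < (m * c) ^ 12 := pow_lt_pow_left₀ hr dist_nonneg (by norm_num)
      _ = 11 / 10 * m ^ 12 := by rw [mul_pow, hc12]; ring
  have hinv12 : (11 / 10 * m ^ 12)⁻¹ < (dist a b)⁻¹ ^ 12 := by
    rw [inv_pow]
    exact (inv_lt_inv₀ (by positivity) (by positivity)).2 hd12
  have hinv6 : (dist a b)⁻¹ ^ 6 ≤ m⁻¹ ^ 6 := by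
    gcongr
  have hd13 : dist a b ≤ 13 / 10 := by
    by_contra h
    push Not at h
    have h1 : (13 / 10 : ℝ) ^ 12 ≤ (dist a b) ^ 12 := pow_le_pow_left₀ (by norm_num) h.le 12
    have h2 : m ^ 12 ≤ (16 / 25 : ℝ) ^ 12 := pow_le_pow_left₀ hm0.le hm16.le 12
    norm_num at h1 h2
    linarith
  -- credited truncation of the site sum at `a` at radius `13/10`
  obtain ⟨N, hN⟩ := exists_finset_near hm0 hmsep a (13 / 10 : ℝ)
  have hlow := sum_near_sub_creditTail_le_tsum hm0 hmsep ha (by norm_num : (0 : ℝ) < 13 / 10) N hN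
  have hcard := card_near_le hm0 hmsep ha (by norm_num : (0 : ℝ) ≤ 13 / 10) N hN
  have hcoef : (0 : ℝ) ≤ 1 / 12 - 1 / 6 * (13 / 10 : ℝ)⁻¹ ^ 6 := by norm_num
  have hCC := mul_le_mul_of_nonneg_left hcard hcoef
  have hbN : b ∈ N := (hN b).2 ⟨hb, Ne.symm hab, by rw [dist_comm]; exact hd13⟩
  have hsplit : ∑ q ∈ N, lennardJones (dist a q) =
      lennardJones (dist a b) + ∑ q ∈ N.erase b, lennardJones (dist a q) :=
    (Finset.add_sum_erase N (fun q => lennardJones (dist a q)) hbN).symm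
  have hrest := neg_card_div_le_sum_lennardJones (N.erase b) fun q => dist a q
  have hcardE : ((N.erase b).card : ℝ) + 1 = N.card := by
    exact_mod_cast Finset.card_erase_add_one hbN
  have hV : lennardJones (dist a b) =
      1 / 12 * (dist a b)⁻¹ ^ 12 - 1 / 6 * (dist a b)⁻¹ ^ 6 := rfl
  have hnum := sepSixteen_numerics h31m hm16.le
  have hUa := hU a ha
  rw [hsplit, hV] at hlow
  linarith

/-- **Composite bootstrap to `16/25`.** A `1/4`-separated `Y ⊆ ℝ³` all of whose Lennard-Jones site
sums are `≤ −711/500` is `16/25`-separated (`sep_of_quarter_thirtyOne` gives `31/50`, then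
`stub_sepSixteen`). [folklore] -/
theorem sep_of_quarter_sixteen {Y : Set E3}
    (hsep : ∀ p ∈ Y, ∀ q ∈ Y, p ≠ q → 1 / 4 ≤ dist p q)
    (hU : ∀ p ∈ Y, ∑' q : {q : E3 // q ∈ Y ∧ q ≠ p}, lennardJones (dist p q.1) ≤ -(711 / 500)) :
    ∀ p ∈ Y, ∀ q ∈ Y, p ≠ q → 16 / 25 ≤ dist p q :=
  stub_sepSixteen Y (sep_of_quarter_thirtyOne hsep hU) hU

/-! ## §38 The credited finite-certificate reduction at separation `16/25` -/

/-- **The rev-7 `(LOCAL)` at separation `16/25` from a CREDITED finite certificate.** The instance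
`(δ, r, Λ) = (16/25, 6, −711/500)` of `local_of_finiteCert_credit_at` (part XIX): if for some
`R' > 0` every finite `16/25`-separated `F ∋ 0` in `{⟪·, u⟫ ≤ 0} ∩ closedBall 0 (6 + R')` has a
site `p`, `dist p 0 ≤ 6`, with
`−711/500 + (1/6)(T(16/25, R') − (#N + 1) R'⁻⁶) < Σ_{q ∈ N} V_LJ(dist p q)` over its near set
`N = {q ∈ F ∖ {p} : dist q p ≤ R'}`, then the registered signature of
`stub_localHalfSpaceCert` (skeleton rev 7) holds literally — `FINCERT(16/25) ⇒ LOCAL(16/25)`.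
[folklore] -/
theorem local_sixteen_of_finiteCert_credit
    (H : ∃ R' : ℝ, 0 < R' ∧
      ∀ (F : Finset (EuclideanSpace ℝ (Fin 3))) (u : EuclideanSpace ℝ (Fin 3)), ‖u‖ = 1 →
        (0 : EuclideanSpace ℝ (Fin 3)) ∈ F →
        (∀ a ∈ F, ∀ b ∈ F, a ≠ b → 16 / 25 ≤ dist a b) →
        (∀ a ∈ F, inner ℝ a u ≤ 0) →
        (∀ a ∈ F, dist a 0 ≤ 6 + R') →
        ∃ p ∈ F, dist p 0 ≤ 6 ∧
          ∀ N : Finset (EuclideanSpace ℝ (Fin 3)),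
            (∀ q, q ∈ N ↔ q ∈ F ∧ q ≠ p ∧ dist q p ≤ R') →
            -(711 / 500) + 1 / 6 * (16 / ((16 / 25) ^ 3 * R' ^ 3) + 18 / ((16 / 25) ^ 2 * R' ^ 4) +
                36 / (5 * (16 / 25) * R' ^ 5) + 1 / R' ^ 6 - ((N.card : ℝ) + 1) * R'⁻¹ ^ 6) <
              ∑ q ∈ N, lennardJones (dist p q)) :
    ∀ (Y : Set (EuclideanSpace ℝ (Fin 3))) (u : EuclideanSpace ℝ (Fin 3)), ‖u‖ = 1 →
      (0 : EuclideanSpace ℝ (Fin 3)) ∈ Y →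
      (∀ p ∈ Y, ∀ q ∈ Y, p ≠ q → 16 / 25 ≤ dist p q) →
      (∀ q ∈ Y, inner ℝ q u ≤ 0) →
      (∀ p ∈ Y, dist p 0 ≤ 6 → ∑' q : {q : EuclideanSpace ℝ (Fin 3) // q ∈ Y ∧ q ≠ p},
          lennardJones (dist p q.1) ≤ -(711 / 500)) →
      False := by
  obtain ⟨R', hR', hcert⟩ := H
  intro Y u hu h0 hsep hhalf hU
  exact local_of_finiteCert_credit_at (δ := 16 / 25) (r := 6) (Λ := -(711 / 500)) (by norm_num)
    (by norm_num) hR' hcert Y u hu h0 hsep hhalf hU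

end Summit.AtomisticToContinuum.Crystallization.Theorems.PerronTransitivityUniformBindingRigidity

end
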